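import Summits.QuantumFields.YangMills.Theorems.FlatTubeReductionPinnedUnitStepExStub1
import Summits.QuantumFields.YangMills.Theorems.FlatTubeReductionPinnedUnitStepExSplitDoor
import Summits.QuantumFields.YangMills.Theorems.FlatTubeReductionPinnedUnitStepExSplitDefs

/-!
# PinnedUnitStepEx (stmt-QuantumFields-27561) — CANDIDATE skeleton «ti-split-1» v3 (NOT registered; planner/LEAD verb `ledger skeleton check`)

Prepared by prover leafhand-qf-flattubereduction-1 g0 (2026-08-30) for the planner of record (ym-idea-1).  Same line as the registered v2
(`HOME/ym-idea-1/PUnitEx_tisplit1_v2.lean`, sha c4da1797): stub 1 `stub_smearVarPosGS1` is CLOSED in the tree (p642758) and is used BY NAME; the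
open v2 stub `stub_pinnedAutocorrExTI1` is SPLIT into its two independent halves through the landed door
`TISplit1.pinnedAutocorrExTI1_of_zeroAvgBound_of_oneStep` (p793860/p794159) and the Defs file `FlatTubeReductionPinnedUnitStepExSplitDefs` (p794322):

* `stub_nonZeroMomentumGapTI1 : NonZeroMomentumGapTI1` — (P1) zero-momentum first excitation along the window, spectral-bound form (size L);
* `stub_oneStepPinnedComparisonTI1 : OneStepPinnedComparisonTI1` — (P2) the one-step two-cutoff comparison ∀ TI φ′ (size XL, the wall).

Composition `PinnedUnitStepEx_holds_of_stubs : PinnedUnitStepEx` kernel-checked (modulo the two `sorry`s).  No summit is proved by any line.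
-/

namespace Summit.QuantumFields.YangMills.Cruxes.PinnedUnitStepEx.TISplit1

open Summit.QuantumFields.YangMills.Theses.FlatTubeReduction
open Summit.QuantumFields.YangMills.Theorems.FemtoTransferGap

/-- STUB 2a (L): (P1) non-zero-momentum gap along the window. -/
theorem stub_nonZeroMomentumGapTI1 : NonZeroMomentumGapTI1 := by
  sorry

/-- STUB 2b (XL): (P2) one-step pinned comparison for every TI coarse excitation. -/
theorem stub_oneStepPinnedComparisonTI1 : OneStepPinnedComparisonTI1 := by
  sorry

/-- The v2 stub 2, recovered from the split (door p794159). -/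
theorem pinnedAutocorrExTI1_of_v3_stubs : PinnedAutocorrExTI1 :=
  pinnedAutocorrExTI1_of_zeroAvgBound_of_oneStep stub_nonZeroMomentumGapTI1 stub_oneStepPinnedComparisonTI1

/-- Kernel-checked composition: the stubs give `PinnedUnitStepEx` (27561) by name (stub 1 = landed `stub_smearVarPosGS1`, p642758). -/
theorem PinnedUnitStepEx_holds_of_stubs : PinnedUnitStepEx := by
  have hA : SmearVarPosGS1 := stub_smearVarPosGS1
  obtain ⟨C, lam0, hlam0, H⟩ := pinnedAutocorrExTI1_of_v3_stubs
  refine ⟨C, lam0, hlam0, fun lam hl hle => ?_⟩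
  obtain ⟨L0, H'⟩ := H lam hl hle
  refine ⟨L0, ?_⟩
  intro L' _ hL0 β β' hw hw' hΛ Ω hΩ hpos hn hE Ω' hΩ' c' hc' hlow hn' hE'
  obtain ⟨φ', hφ', hTI, horth, hn1, hE1, hB⟩ := H' L' hL0 β β' hw hw' hΛ Ω hΩ hpos hn hE Ω' hΩ' c' hc' hlow hn' hE'
  exact ⟨φ', hφ', horth, hn1, hE1, ⟨hA L' β' Ω hΩ hpos hn Ω' hΩ' c' hc' hlow hn' hE' φ' hφ' hTI horth hn1, hB⟩⟩

end Summit.QuantumFields.YangMills.Cruxes.PinnedUnitStepEx.TISplit1
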